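import Summits.BirchSwinnertonDyer.BirchSwinnertonDyer.Theorems.UniversalToricDescentLayerKummerProduct
import Summits.BirchSwinnertonDyer.BirchSwinnertonDyer.Theorems.UniversalToricDescentSigmaLocalStabilizer
import HarnessLib

/-!
# The TAME local factors of the layer Poitou–Tate count along the `ℤ_p`-tower, bounded uniformly in the layer:
# `∏_{w ∈ T} #𝓛_w(E/K_m, p^k) ≤ p^{2k·#T}` and `#T ≤ B` for the places `T` of `K_m` over a finite set of finitely decomposed tame places
# (local conversions for the port stub `stub_residualLinkMult`, line `beta-road` v5 on crux `TwinAlgMuZeroAtThree`, stmt-BirchSwinnertonDyer-24737)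

Width prover `bsd-wall-utd-p1-w2` g9 under lead `bsd-wall-utd-p1` g23 (`--supports stmt-BirchSwinnertonDyer-24737`, helper).
THEOREMS ONLY (no definition, no named fact, no `sorry`). BSD is not proved by any of this.

Setting: `K` a number field, `p` a prime, `κ : Γ_K ↠ ℤ_p` a `ℤ_p`-extension with layers `K_m = κ.layer m`, `E = W/K` an elliptic curve,
`𝓛_w = 𝓛_w(E/K_m, p^k)` the local `p^k`-Kummer condition at a finite place `w` of `K_m` (`(W.baseChange (κ.layer m)).kummerSelmerStructure (p^k) (inr w)`;
`#𝓛_w = #E(K_{m,w})[p^k] · #(𝓞_w/p^k)`, Milne I 3.3). These are the factors `∏_{w∈T} #𝓛_w` on the right-hand side of the layer count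
`…RelaxedStrictMixedCount.natCard_mixed_mul_strictIndex_mul_strictIndex_le` (p739978, this seat) at `L = K_m`, `T` = the places over the
finite bad set `Σ₀`; the lead's reduction `…ResidualLinkOfLayerCount.residual_finite_of_twoSidedLayerCount` (g23) consumes them in the shape
`≤ p^{c}` with `c` INDEPENDENT of `m`. Companion file `…LayerLocalFactorsAtP` treats the places over the degree-one prime `𝔭 ∣ p`.

* §1 `natCard_kummerSelmerStructure_inr_layer_le`, **`prod_natCard_kummerSelmerStructure_inr_layer_le_pow`** — at places `w` of `K_m` over
  tame places (`w ∩ K ∌ p`): `#𝓛_w = #E[p^k]^{D_v ⊓ Γ_m} ≤ #E[p^k] = p^{2k}` (w2-g3 `…LayerKummerProduct.natCard_kummerSelmerStructure_inr_layer_eq`),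
  so `∏_{w ∈ T} #𝓛_w ≤ p^{2k·#T}`.
* §2 `natCard_placesOver_layer_le_pow` — a tame place `v` with EXACT index `κ(D_v) = p^c ℤ_p` has **at most `p^c` places above it in
  EVERY layer** (`= p^{min(m,c)}`: the tree's `ZpTower.card_placesOver_layer_mul_pow_eq` for all `m`, with `κ(Frob_v) = p^c·unit` from
  `…LayerKummerProduct.exists_isUnit_toAdd_frob_eq`); **`exists_forall_card_placesOver_le`** — for a FINITE set `Σ₀` of tame places finitely
  decomposed in `K_∞` (`D_v ⊄ ker κ`; exact index by `…SigmaLocalStabilizer.exists_pow_and_forall_dvd_of_not_le`) there is `B` with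
  `#{w ∣ Σ₀ in K_m} ≤ B` for all `m`; hence **`exists_forall_prod_natCard_kummerSelmerStructure_le_pow`** : `∏_{w ∣ Σ₀} #𝓛_w ≤ p^{2kB}` for
  all `m`, `k`.

References: [MilneADT2006] I Lemma 3.3; [Washington1997] §13.1, Prop. 13.2; [GreenbergLNM1716] §1 (p. 60), §2 (pp. 62–63);
[GreenbergVatsal2000] §2 pp. 22–24; [Brink2007] Cor. 1.
-/


set_option linter.dupNamespace false
set_option autoImplicit false

noncomputable section
open scoped Classical
open Field NumberField IsDedekindDomain Function WeierstrassCurve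
open Literature.NumberTheory.EllipticCurves Literature.NumberTheory.EllipticCurves.GreenbergSelmer
open Literature.NumberTheory.GaloisRepresentations

namespace Summit.BirchSwinnertonDyer.BirchSwinnertonDyer.Theorems.UniversalToricDescentLayerLocalFactors

open Summit.BirchSwinnertonDyer.Rank1Residual.Additive Summit.BirchSwinnertonDyer.Rank1Residual.Additive.ZpTower
  Summit.BirchSwinnertonDyer.Rank1Residual.X11b.AcSelmer
  Summit.BirchSwinnertonDyer.BirchSwinnertonDyer.Theorems.UniversalToricDescentLayerLocalTorsionDictionary
  Summit.BirchSwinnertonDyer.BirchSwinnertonDyer.Theorems.UniversalToricDescentLayerKummerProduct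
  Summit.BirchSwinnertonDyer.BirchSwinnertonDyer.Theorems.UniversalToricDescentSigmaLocalStabilizer

/-! ## §1 Tame places: `#𝓛_w ≤ #E[p^k] = p^{2k}` -/

section Tame

variable {K : Type} [Field K] [NumberField K] {p : ℕ} [Fact p.Prime] (κ : ZpExtension K p)
  (W : WeierstrassCurve K) [W.IsElliptic]

/-- **`#𝓛_w(E/K_m, p^k) ≤ p^{2k}` at a place `w` of the layer `K_m` above a tame place `v ∤ p`**: `#𝓛_w = #E[p^k]^{D_v ⊓ Γ_m}`
(`…LayerKummerProduct.natCard_kummerSelmerStructure_inr_layer_eq`) `≤ #E[p^k] = p^{2k}` (Silverman III.6.4, tree `card_torsionBy_eq_sq`;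
same evaluation as `PrintCFram.BorelHomothety.natCard_geomTorsion_pow`). [cite: MilneADT2006, I §3 Lemma 3.3] [cite: GreenbergLNM1716, §2 (pp. 62–63)]
[cite: SilvermanAEC2009, Cor. III.6.4] -/
theorem natCard_kummerSelmerStructure_inr_layer_le {v : HeightOneSpectrum (𝓞 K)} (hpv : ((p : ℕ) : 𝓞 K) ∉ v.asIdeal)
    (m k : ℕ) (w : HeightOneSpectrum (𝓞 (κ.layer m))) (hw : w.under (𝓞 K) = v) :
    Nat.card ((W.baseChange (κ.layer m)).kummerSelmerStructure ((p ^ k : ℕ) : ℤ) (Sum.inr w)) ≤ p ^ (2 * k) := by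
  have hp : p.Prime := Fact.out
  haveI : Finite (W.geomTorsion ((p ^ k : ℕ) : ℤ)) := finite_geomTorsion_pow W p k
  have hne : ((p ^ k : ℕ) : AlgebraicClosure K) ≠ 0 := Nat.cast_ne_zero.mpr (pow_ne_zero k hp.ne_zero)
  have hcard : Nat.card (W.geomTorsion ((p ^ k : ℕ) : ℤ)) = (p ^ k) ^ 2 :=
    (W.baseChange (AlgebraicClosure K)).card_torsionBy_eq_sq hne
  rw [natCard_kummerSelmerStructure_inr_layer_eq p κ v W hpv m k w hw, pow_mul', ← hcard]
  exact Finite.card_subtype_le _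

/-- **`∏_{w ∈ T} #𝓛_w(E/K_m, p^k) ≤ p^{2k·#T}`** for any finset `T` of places of the layer `K_m` lying over tame places of `K`.
[cite: MilneADT2006, I §3 Lemma 3.3] [cite: GreenbergVatsal2000, §2 pp. 22–24] -/
theorem prod_natCard_kummerSelmerStructure_inr_layer_le_pow (m k : ℕ) (T : Finset (HeightOneSpectrum (𝓞 (κ.layer m))))
    (hT : ∀ w ∈ T, ((p : ℕ) : 𝓞 K) ∉ (w.under (𝓞 K)).asIdeal) :
    ∏ w ∈ T, Nat.card ((W.baseChange (κ.layer m)).kummerSelmerStructure ((p ^ k : ℕ) : ℤ) (Sum.inr w)) ≤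
      p ^ (2 * k * T.card) := by
  rw [pow_mul]
  exact Finset.prod_le_pow_card T _ _ fun w hw ↦
    natCard_kummerSelmerStructure_inr_layer_le κ W (hT w hw) m k w rfl

end Tame

/-! ## §2 The number of places of a layer above a finitely decomposed tame place is bounded -/

section Places

variable {K : Type} [Field K] [NumberField K] {p : ℕ} [Fact p.Prime] (κ : ZpExtension K p)

/-- **`#{w ∣ v in K_m} ≤ p^c` for EVERY layer `m`** at a tame place `v ∤ p` with exact index `κ(D_v) = p^c ℤ_p` (`d₁ ∈ D_v` with
`κ d₁ = p^c`, `p^c ∣ κ d` on `D_v`): the tree's `#{w ∣ v in K_m} · p^{m − c} = p^m` (`ZpTower.card_placesOver_layer_mul_pow_eq`, `v`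
unramified in `K_∞`, `κ(Frob_v) = p^c · unit` by `…LayerKummerProduct.exists_isUnit_toAdd_frob_eq`) gives `#{w ∣ v} = p^{min(m,c)}`.
[cite: Washington1997, §13.1 and Prop. 13.2] [cite: NeukirchANT1999, Ch. I §9 Prop. (9.4)] [cite: GreenbergLNM1716, §1 (p. 60)] -/
theorem natCard_placesOver_layer_le_pow {v : HeightOneSpectrum (𝓞 K)} (hpv : ((p : ℕ) : 𝓞 K) ∉ v.asIdeal) {c : ℕ}
    (d₁ : decomp (K := K) v) (hd₁ : (κ (d₁ : absoluteGaloisGroup K)).toAdd = (p : ℤ_[p]) ^ c)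
    (hdiv : ∀ d : decomp (K := K) v, (p : ℤ_[p]) ^ c ∣ (κ (d : absoluteGaloisGroup K)).toAdd) (m : ℕ) :
    Nat.card {w : HeightOneSpectrum (𝓞 (κ.layer m)) // w.under (𝓞 K) = v} ≤ p ^ c := by
  have hp : p.Prime := Fact.out
  obtain ⟨φ, hφ⟩ := HeightOneSpectrum.exists_isArithFrobAt_of_mem_primesAbove_holds (K := K) (v := v)
    (adicCompletionPrime_mem_primesAbove K v)
  obtain ⟨u, hu, hφu⟩ := exists_isUnit_toAdd_frob_eq κ v hpv hφ d₁ hd₁ hdiv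
  have h := card_placesOver_layer_mul_pow_eq κ m (adicCompletionPrime_mem_primesAbove K v)
    (ZpExtension.inertia_le_kerSubgroup_holds K p κ hpv (adicCompletionPrime_mem_primesAbove K v)) hφ hu hφu
  rcases le_total m c with hmc | hcm
  · rw [Nat.sub_eq_zero_of_le hmc, pow_zero, mul_one] at h
    rw [h]
    exact Nat.pow_le_pow_right hp.pos hmc
  · have hpm : p ^ m = p ^ c * p ^ (m - c) := by rw [← pow_add, Nat.add_sub_cancel' hcm]
    rw [hpm] at h
    exact (Nat.eq_of_mul_eq_mul_right (Nat.pos_of_ne_zero (pow_ne_zero _ hp.ne_zero)) h).le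

/-- Finset form: a finset `V` of places of `K_m` all lying over `v` has at most `p^c` elements. [cite: Washington1997, §13.1] -/
theorem card_le_pow_of_forall_under_eq {v : HeightOneSpectrum (𝓞 K)} (hpv : ((p : ℕ) : 𝓞 K) ∉ v.asIdeal) {c : ℕ}
    (d₁ : decomp (K := K) v) (hd₁ : (κ (d₁ : absoluteGaloisGroup K)).toAdd = (p : ℤ_[p]) ^ c)
    (hdiv : ∀ d : decomp (K := K) v, (p : ℤ_[p]) ^ c ∣ (κ (d : absoluteGaloisGroup K)).toAdd) (m : ℕ)
    (V : Finset (HeightOneSpectrum (𝓞 (κ.layer m)))) (hV : ∀ w ∈ V, w.under (𝓞 K) = v) :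
    V.card ≤ p ^ c := by
  haveI : Finite {w : HeightOneSpectrum (𝓞 (κ.layer m)) // w.under (𝓞 K) = v} := finite_heightOneSpectrum_under_eq v
  calc V.card = Nat.card (V : Set (HeightOneSpectrum (𝓞 (κ.layer m)))) := by
        rw [Nat.card_coe_set_eq, Set.ncard_coe_finset]
    _ ≤ Nat.card {w : HeightOneSpectrum (𝓞 (κ.layer m)) // w.under (𝓞 K) = v} :=
        Nat.card_le_card_of_injective (fun w ↦ ⟨w.1, hV w.1 w.2⟩) fun a b h ↦
          Subtype.ext (congrArg (fun x : {w : HeightOneSpectrum (𝓞 (κ.layer m)) // w.under (𝓞 K) = v} ↦ x.1) h)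
    _ ≤ p ^ c := natCard_placesOver_layer_le_pow κ hpv d₁ hd₁ hdiv m

/-- **Uniformly many places above a finite set of finitely decomposed tame places.** For a finite set `Σ₀` of places `v ∤ p` of `K`
with `D_v ⊄ Gal(K̄/K_∞)` there is `B` such that every finset of places of any layer `K_m` lying over `Σ₀` has at most `B` elements
(`B = Σ_{v∈Σ₀} p^{c_v}`, `c_v` the exact index). [cite: Brink2007, Cor. 1 (p. 2136)] [cite: Washington1997, §13.1]
[cite: GreenbergLNM1716, §1 ("finitely decomposed")] -/
theorem exists_forall_card_placesOver_le {S₀ : Set (HeightOneSpectrum (𝓞 K))} (hS₀ : S₀.Finite)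
    (hS₀p : ∀ v ∈ S₀, ((p : ℕ) : 𝓞 K) ∉ v.asIdeal) (hS₀dec : ∀ v ∈ S₀, ¬ (decomp v ≤ κ.kerSubgroup)) :
    ∃ B : ℕ, ∀ (m : ℕ) (T : Finset (HeightOneSpectrum (𝓞 (κ.layer m)))),
      (∀ w ∈ T, w.under (𝓞 K) ∈ S₀) → T.card ≤ B := by
  -- exact indices, place by place
  have hex : ∀ v : HeightOneSpectrum (𝓞 K), ∃ c : ℕ, v ∈ S₀ →
      ∀ (m : ℕ) (V : Finset (HeightOneSpectrum (𝓞 (κ.layer m)))), (∀ w ∈ V, w.under (𝓞 K) = v) → V.card ≤ p ^ c := by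
    intro v
    by_cases hv : v ∈ S₀
    · obtain ⟨c, ⟨d₁, hd₁⟩, -, hdiv⟩ := exists_pow_and_forall_dvd_of_not_le κ v (hS₀dec v hv)
      exact ⟨c, fun _ m V hV ↦ card_le_pow_of_forall_under_eq κ (hS₀p v hv) d₁ hd₁ hdiv m V hV⟩
    · exact ⟨0, fun h ↦ (hv h).elim⟩
  choose c hc using hex
  refine ⟨∑ v ∈ hS₀.toFinset, p ^ c v, fun m T hT ↦ ?_⟩
  -- split `T` along the places of `K` below
  have hcover : T = hS₀.toFinset.biUnion fun v ↦ T.filter fun w ↦ w.under (𝓞 K) = v := by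
    ext w
    simp only [Finset.mem_biUnion, Set.Finite.mem_toFinset, Finset.mem_filter]
    exact ⟨fun hw ↦ ⟨w.under (𝓞 K), hT w hw, hw, rfl⟩, fun ⟨_, _, hw, _⟩ ↦ hw⟩
  rw [hcover]
  refine Finset.card_biUnion_le.trans (Finset.sum_le_sum fun v hv ↦ ?_)
  exact hc v (by simpa using hv) m _ fun w hw ↦ (Finset.mem_filter.mp hw).2

variable (W : WeierstrassCurve K) [W.IsElliptic]

/-- **`∏_{w ∣ Σ₀} #𝓛_w(E/K_m, p^k) ≤ p^{2kB}` for all `m`, `k`** — §1 and the place bound. This is the tame part of the local factor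
of the layer Poitou–Tate count, uniform in the layer. [cite: MilneADT2006, I §3 Lemma 3.3] [cite: GreenbergVatsal2000, §2 pp. 22–24] -/
theorem exists_forall_prod_natCard_kummerSelmerStructure_le_pow {S₀ : Set (HeightOneSpectrum (𝓞 K))} (hS₀ : S₀.Finite)
    (hS₀p : ∀ v ∈ S₀, ((p : ℕ) : 𝓞 K) ∉ v.asIdeal) (hS₀dec : ∀ v ∈ S₀, ¬ (decomp v ≤ κ.kerSubgroup)) :
    ∃ B : ℕ, ∀ (m k : ℕ) (T : Finset (HeightOneSpectrum (𝓞 (κ.layer m)))),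
      (∀ w ∈ T, w.under (𝓞 K) ∈ S₀) →
      ∏ w ∈ T, Nat.card ((W.baseChange (κ.layer m)).kummerSelmerStructure ((p ^ k : ℕ) : ℤ) (Sum.inr w)) ≤
        p ^ (2 * k * B) := by
  have hp : p.Prime := Fact.out
  obtain ⟨B, hB⟩ := exists_forall_card_placesOver_le κ hS₀ hS₀p hS₀dec
  refine ⟨B, fun m k T hT ↦ ?_⟩
  refine (prod_natCard_kummerSelmerStructure_inr_layer_le_pow κ W m k T fun w hw ↦ hS₀p _ (hT w hw)).trans ?_
  exact Nat.pow_le_pow_right hp.pos (Nat.mul_le_mul_left _ (hB m T hT))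

end Places

end Summit.BirchSwinnertonDyer.BirchSwinnertonDyer.Theorems.UniversalToricDescentLayerLocalFactors

end
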